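import Summits.AtomisticToContinuum.HydrodynamicLimit.Theses.AntiMazurCoboundaries
import Literature.MathematicalPhysics.KineticTheory.HardSphereEulerProofs
import Literature.Probability.Divergences.FDivVariational

/-!
# Gibbs variational principle for the discrete-window optimiser (stub 1)

Helper file (`--supports stmt-AtomisticToContinuum-14135`) proving the registered stub `stub_gibbsOneBodyDuality` of the lead's skeleton
`Cruxes/CorrectorPressureDecay/Lines/kinetic-entropy-collision-budget.lean` (line `kinetic-entropy-collision-budget`) of
the crux `Summit.AtomisticToContinuum.HydrodynamicLimit.Theses.AntiMazurCoboundaries.CorrectorPressureDecay`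
(stmt-AtomisticToContinuum-14135, route `AntiMazurCoboundaries`). The statement is spelled over tree primitives exactly
as registered; see the skeleton for the objects it abbreviates (`discAvg`, `optimiser`, `windowOneBodyLaw`, `condKL`,
`fastDev`).

Proof. Three generic lemmas and a bookkeeping identity:
* `tilted_klDiv_toReal_eq` — for a probability measure `μ` and a bounded measurable `f`, the tilt `Q = μ.tilted f`
  is a probability measure, `Q ≪ μ`, `KL(Q‖μ) < ∞` and `KL(Q‖μ) = ∫ f dQ − log ∫ e^f dμ` EXACTLY (the equality case
  of the Gibbs / Donsker–Varadhan variational principle: `llr Q μ = f − log Z` a.e., Mathlib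
  `log_rnDeriv_tilted_left_self`, integrated against `Q`; `toReal_klDiv_of_measure_eq`);
* `lintegral_exp_le_of_tilted_budget` — hence `∫ f dQ − KL(Q‖μ) ≤ B ⟹ ∫ e^f dμ ≤ e^B`;
* `two_mul_integral_windowLaw_eq` — push-forward bookkeeping: the `φ⊗g`-moment of the symmetrised window-averaged
  one-body law `Π̄(Q) = ((N+1)n)⁻¹ Σᵢ Σⱼ (xᵢ(tⱼ), ṽᵢ(tⱼ))_# Q` satisfies `2(N+1) ∫ φ⊗g dΠ̄(Q) = E_Q[2A]`
  (`integral_smul_measure`, `integral_finsetSum_measure`, `integral_map`, `Finset.sum_comm`).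
The registered statement follows by `subst`ituting `Q` and instantiating `f := 2A` (measurable by `Φ.measurable_flow`
and continuity of `φ, g`; bounded by `2 n⁻¹ Σⱼ Σᵢ C_φ C_g`).
-/

noncomputable section

open MeasureTheory ProbabilityTheory InformationTheory Set Filter Topology
open scoped ENNReal

namespace Summit.AtomisticToContinuum.HydrodynamicLimit.Theorems.KineticEntropyCollisionBudget

open Literature.MathematicalPhysics.KineticTheory (T3 V3 hsDiameter localGibbsLaw)
open Literature.Analysis.FluidPDE (HardSphereFlow Config)

/-- For a bounded function the exponential is integrable against a finite measure. -/
theorem integrable_exp_of_abs_le {α : Type*} [MeasurableSpace α] {μ : Measure α} [IsFiniteMeasure μ]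
    {f : α → ℝ} (hfm : Measurable f) {C : ℝ} (hfC : ∀ x, |f x| ≤ C) :
    Integrable (fun x => Real.exp (f x)) μ := by
  refine Integrable.of_bound (hfm.exp).aestronglyMeasurable (Real.exp C) (ae_of_all _ fun x => ?_)
  rw [Real.norm_eq_abs, abs_of_pos (Real.exp_pos _)]
  exact Real.exp_le_exp.2 ((le_abs_self _).trans (hfC x))

/-- **Gibbs variational principle, equality case at the tilt.** For a probability measure `μ` and a bounded
measurable `f`, the tilted measure `Q = μ.tilted f = e^f μ / Z` is a probability measure, `Q ≪ μ`, its
Kullback–Leibler divergence is finite and `KL(Q ‖ μ) = ∫ f dQ − log Z`, `Z = ∫ e^f dμ`. -/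
theorem tilted_klDiv_toReal_eq {α : Type*} [MeasurableSpace α] {μ : Measure α} [IsProbabilityMeasure μ]
    {f : α → ℝ} (hfm : Measurable f) {C : ℝ} (hfC : ∀ x, |f x| ≤ C) :
    IsProbabilityMeasure (μ.tilted f) ∧ μ.tilted f ≪ μ ∧ klDiv (μ.tilted f) μ ≠ ∞ ∧
      (klDiv (μ.tilted f) μ).toReal =
        ∫ x, f x ∂(μ.tilted f) - Real.log (∫ x, Real.exp (f x) ∂μ) := by
  have hexp : Integrable (fun x => Real.exp (f x)) μ := integrable_exp_of_abs_le hfm hfC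
  haveI hQ : IsProbabilityMeasure (μ.tilted f) := isProbabilityMeasure_tilted hexp
  have hac : μ.tilted f ≪ μ := tilted_absolutelyContinuous μ f
  have hllr : llr (μ.tilted f) μ =ᵐ[μ.tilted f]
      fun x => f x - Real.log (∫ x, Real.exp (f x) ∂μ) :=
    hac.ae_le (log_rnDeriv_tilted_left_self hexp)
  have hfi : Integrable f (μ.tilted f) :=
    Integrable.of_bound hfm.aestronglyMeasurable C (ae_of_all _ fun x => by
      rw [Real.norm_eq_abs]; exact hfC x)
  have hsub : Integrable (fun x => f x - Real.log (∫ x, Real.exp (f x) ∂μ)) (μ.tilted f) :=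
    hfi.sub (integrable_const _)
  have hint : Integrable (llr (μ.tilted f) μ) (μ.tilted f) := (integrable_congr hllr).2 hsub
  refine ⟨hQ, hac, klDiv_ne_top hac hint, ?_⟩
  rw [toReal_klDiv_of_measure_eq hac (by simp), integral_congr_ae hllr,
    integral_sub hfi (integrable_const _), integral_const, probReal_univ, one_smul]

/-- **Exponential moment from the Gibbs budget.** With `Q = μ.tilted f` as above, a budget
`∫ f dQ − KL(Q ‖ μ) ≤ B` is `log ∫ e^f dμ ≤ B`, i.e. `∫ e^f dμ ≤ e^B`. -/
theorem lintegral_exp_le_of_tilted_budget {α : Type*} [MeasurableSpace α] {μ : Measure α}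
    [IsProbabilityMeasure μ] {f : α → ℝ} (hfm : Measurable f) {C : ℝ} (hfC : ∀ x, |f x| ≤ C) {B : ℝ}
    (hB : ∫ x, f x ∂(μ.tilted f) - (klDiv (μ.tilted f) μ).toReal ≤ B) :
    ∫⁻ x, ENNReal.ofReal (Real.exp (f x)) ∂μ ≤ ENNReal.ofReal (Real.exp B) := by
  have hexp : Integrable (fun x => Real.exp (f x)) μ := integrable_exp_of_abs_le hfm hfC
  have hZ : 0 < ∫ x, Real.exp (f x) ∂μ := integral_exp_pos hexp
  rw [(tilted_klDiv_toReal_eq hfm hfC).2.2.2, sub_sub_cancel] at hB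
  rw [← ofReal_integral_eq_lintegral_ofReal hexp (ae_of_all _ fun _ => (Real.exp_pos _).le)]
  refine ENNReal.ofReal_le_ofReal ?_
  rw [← Real.exp_log hZ]
  exact Real.exp_le_exp.2 hB

/-- **Push-forward bookkeeping for the symmetrised window-averaged one-body law.** For a finite measure `Q`,
measurable position/velocity observables `x i j, v i j` and bounded continuous `φ, g`:
`2(N+1) ∫ φ(p.1) g(p.2) d[((N+1)n)⁻¹ Σᵢ Σⱼ (x i j, v i j)_# Q] = ∫ 2 n⁻¹ Σⱼ Σᵢ φ(x i j z) g(v i j z) dQ(z)`. -/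
theorem two_mul_integral_windowLaw_eq {α : Type*} [MeasurableSpace α] (Q : Measure α) [IsFiniteMeasure Q]
    {N n : ℕ} (x : Fin (N + 1) → Fin n → α → T3) (v : Fin (N + 1) → Fin n → α → V3)
    (hx : ∀ i j, Measurable (x i j)) (hv : ∀ i j, Measurable (v i j))
    {φ : T3 → ℝ} {g : V3 → ℝ} (hφ : Continuous φ) (hg : Continuous g) {Cφ Cg : ℝ}
    (hCφ : ∀ y, |φ y| ≤ Cφ) (hCg : ∀ w, |g w| ≤ Cg) :
    2 * ((N : ℝ) + 1) * ∫ p, φ p.1 * g p.2 ∂((((N + 1 : ℕ) : ℝ≥0∞)⁻¹ * ((n : ℝ≥0∞))⁻¹) •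
        ∑ i : Fin (N + 1), ∑ j : Fin n, Q.map (fun z => (x i j z, v i j z))) =
      ∫ z, 2 * ((n : ℝ)⁻¹ * ∑ j : Fin n, ∑ i, φ (x i j z) * g (v i j z)) ∂Q := by
  have hh : Measurable fun p : T3 × V3 => φ p.1 * g p.2 :=
    (hφ.measurable.comp measurable_fst).mul (hg.measurable.comp measurable_snd)
  have hCφ0 : 0 ≤ Cφ := (abs_nonneg _).trans (hCφ 0)
  have hbd : ∀ (y : T3) (w : V3), ‖φ y * g w‖ ≤ Cφ * Cg := fun y w => by
    rw [Real.norm_eq_abs, abs_mul]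
    exact mul_le_mul (hCφ _) (hCg _) (abs_nonneg _) hCφ0
  have hint : ∀ (ν : Measure (T3 × V3)) [IsFiniteMeasure ν],
      Integrable (fun p : T3 × V3 => φ p.1 * g p.2) ν := fun ν _ =>
    Integrable.of_bound hh.aestronglyMeasurable _ (ae_of_all _ fun p => hbd p.1 p.2)
  have hint' : ∀ i j, Integrable (fun z => φ (x i j z) * g (v i j z)) Q := fun i j =>
    Integrable.of_bound
      (((hφ.measurable.comp (hx i j)).mul (hg.measurable.comp (hv i j))).aestronglyMeasurable) _
      (ae_of_all _ fun z => hbd (x i j z) (v i j z))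
  have h1 : ∀ i j, ∫ p, φ p.1 * g p.2 ∂(Q.map (fun z => (x i j z, v i j z))) =
      ∫ z, φ (x i j z) * g (v i j z) ∂Q := fun i j =>
    integral_map ((hx i j).prodMk (hv i j)).aemeasurable hh.aestronglyMeasurable
  have h2 : ∀ i, ∫ p, φ p.1 * g p.2 ∂(∑ j, Q.map (fun z => (x i j z, v i j z))) =
      ∑ j, ∫ z, φ (x i j z) * g (v i j z) ∂Q := by
    intro i
    rw [integral_finsetSum_measure fun j _ => hint _]
    exact Finset.sum_congr rfl fun j _ => h1 i j
  have h3 : ∫ p, φ p.1 * g p.2 ∂(∑ i, ∑ j, Q.map (fun z => (x i j z, v i j z))) =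
      ∑ i, ∑ j, ∫ z, φ (x i j z) * g (v i j z) ∂Q := by
    rw [integral_finsetSum_measure fun i _ => integrable_finsetSum_measure.2 fun j _ => hint _]
    exact Finset.sum_congr rfl fun i _ => h2 i
  have h4 : ∫ z, 2 * ((n : ℝ)⁻¹ * ∑ j : Fin n, ∑ i, φ (x i j z) * g (v i j z)) ∂Q =
      2 * ((n : ℝ)⁻¹ * ∑ i, ∑ j : Fin n, ∫ z, φ (x i j z) * g (v i j z) ∂Q) := by
    rw [integral_const_mul, integral_const_mul,
      integral_finsetSum _ fun j _ => integrable_finsetSum _ fun i _ => hint' i j,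
      Finset.sum_comm]
    congr 2
    exact Finset.sum_congr rfl fun j _ => integral_finsetSum _ fun i _ => hint' i j
  have hN : ((N : ℝ) + 1) ≠ 0 := by positivity
  rw [integral_smul_measure, h3, h4, smul_eq_mul, ENNReal.toReal_mul, ENNReal.toReal_inv,
    ENNReal.toReal_inv, ENNReal.toReal_natCast, ENNReal.toReal_natCast]
  push_cast
  calc 2 * ((N : ℝ) + 1) * (((N : ℝ) + 1)⁻¹ * ((n : ℝ))⁻¹ *
        ∑ i, ∑ j : Fin n, ∫ z, φ (x i j z) * g (v i j z) ∂Q)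
      = 2 * (((N : ℝ) + 1) * ((N : ℝ) + 1)⁻¹) *
          (((n : ℝ))⁻¹ * ∑ i, ∑ j : Fin n, ∫ z, φ (x i j z) * g (v i j z) ∂Q) := by ring
    _ = 2 * (((n : ℝ))⁻¹ * ∑ i, ∑ j : Fin n, ∫ z, φ (x i j z) * g (v i j z) ∂Q) := by
      rw [mul_inv_cancel₀ hN, mul_one]

/-- **Registered stub `stub_gibbsOneBodyDuality`** (line `kinetic-entropy-collision-budget`, crux stmt-AtomisticToContinuum-14135): Gibbs variational principle at the tilt `Q = G_N.tilted(2A)` in one-body form — `Q` is a probability law, `Q ≪ G_N`, `KL(Q‖G_N) < ∞`, and `2(N+1)∫φ⊗g dΠ̄(Q) − KL(Q‖G_N) ≤ B ⟹ ∫e^{2A}dG_N ≤ e^B`. -/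
theorem stub_gibbsOneBodyDuality :
    ∀ (σ a θ : ℝ) (u₀ : V3), 0 < σ → σ ≤ 1 / 2 → 0 < a → 0 < θ →
      ∀ (N : ℕ) (Φ : HardSphereFlow (Literature.Analysis.FluidPDE.Torus.geometry (Fin 3)) (hsDiameter σ N) (N + 1)) (φ : T3 → ℝ) (g : V3 → ℝ),
        Continuous φ → Continuous g → (∃ C : ℝ, ∀ x, |φ x| ≤ C) → (∃ C : ℝ, ∀ v, |g v| ≤ C) →
        ∀ (n : ℕ) (lag : ℝ), 1 ≤ n →
        ∀ Q : Measure (Config (N + 1) (Fin 3) T3),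
          Q = (localGibbsLaw σ (fun _ => a) (fun _ => u₀) (fun _ => θ) N Φ).tilted (fun z => 2 * ((n : ℝ)⁻¹ * ∑ j : Fin n, ∑ i, φ (Φ.flow ((((j : ℕ) : ℝ) + 1) * lag) z i).1 * g ((Real.sqrt θ)⁻¹ • ((Φ.flow ((((j : ℕ) : ℝ) + 1) * lag) z i).2 - u₀)))) →
          IsProbabilityMeasure Q ∧ Q ≪ localGibbsLaw σ (fun _ => a) (fun _ => u₀) (fun _ => θ) N Φ ∧ klDiv Q (localGibbsLaw σ (fun _ => a) (fun _ => u₀) (fun _ => θ) N Φ) ≠ ∞ ∧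
          ∀ B : ℝ,
            2 * ((N : ℝ) + 1) * ∫ p, φ p.1 * g p.2 ∂((((N + 1 : ℕ) : ℝ≥0∞)⁻¹ * ((n : ℝ≥0∞))⁻¹) • ∑ i : Fin (N + 1), ∑ j : Fin n, (Q).map (fun z => ((Φ.flow ((((j : ℕ) : ℝ) + 1) * lag) z i).1, (Real.sqrt θ)⁻¹ • ((Φ.flow ((((j : ℕ) : ℝ) + 1) * lag) z i).2 - u₀)))) - (klDiv Q (localGibbsLaw σ (fun _ => a) (fun _ => u₀) (fun _ => θ) N Φ)).toReal ≤ B →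
            ∫⁻ z, ENNReal.ofReal (Real.exp (2 * ((n : ℝ)⁻¹ * ∑ j : Fin n, ∑ i, φ (Φ.flow ((((j : ℕ) : ℝ) + 1) * lag) z i).1 * g ((Real.sqrt θ)⁻¹ • ((Φ.flow ((((j : ℕ) : ℝ) + 1) * lag) z i).2 - u₀))))) ∂(localGibbsLaw σ (fun _ => a) (fun _ => u₀) (fun _ => θ) N Φ) ≤ ENNReal.ofReal (Real.exp B) := by
  intro σ a θ u₀ _hσ hσ2 ha hθ N Φ φ g hφ hg hφb hgb n lag _hn Q hQ
  obtain ⟨Cφ, hCφ⟩ := hφb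
  obtain ⟨Cg, hCg⟩ := hgb
  haveI : IsProbabilityMeasure (localGibbsLaw σ (fun _ => a) (fun _ => u₀) (fun _ => θ) N Φ) :=
    Literature.MathematicalPhysics.KineticTheory.isProbabilityMeasure_localGibbsLaw continuous_const
      continuous_const continuous_const (fun _ => ha) (fun _ => hθ) hσ2 N Φ
  -- measurability of the one-body observables along the flow
  have hx : ∀ (i : Fin (N + 1)) (j : Fin n), Measurable fun z : Config (N + 1) (Fin 3) T3 =>
      (Φ.flow ((((j : ℕ) : ℝ) + 1) * lag) z i).1 := fun i j =>
    measurable_fst.comp ((measurable_pi_apply i).comp (Φ.measurable_flow _))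
  have hv : ∀ (i : Fin (N + 1)) (j : Fin n), Measurable fun z : Config (N + 1) (Fin 3) T3 =>
      (Real.sqrt θ)⁻¹ • ((Φ.flow ((((j : ℕ) : ℝ) + 1) * lag) z i).2 - u₀) := fun i j =>
    (measurable_const_smul _).comp
      ((measurable_snd.comp ((measurable_pi_apply i).comp (Φ.measurable_flow _))).sub_const u₀)
  have hCφ0 : 0 ≤ Cφ := (abs_nonneg _).trans (hCφ 0)
  -- the tilt `f = 2A` is measurable and bounded
  have hFm : Measurable fun z : Config (N + 1) (Fin 3) T3 =>
      2 * ((n : ℝ)⁻¹ * ∑ j : Fin n, ∑ i, φ (Φ.flow ((((j : ℕ) : ℝ) + 1) * lag) z i).1 *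
        g ((Real.sqrt θ)⁻¹ • ((Φ.flow ((((j : ℕ) : ℝ) + 1) * lag) z i).2 - u₀))) := by
    refine measurable_const.mul (measurable_const.mul
      (Finset.measurable_sum _ fun j _ => Finset.measurable_sum _ fun i _ => ?_))
    exact (hφ.measurable.comp (hx i j)).mul (hg.measurable.comp (hv i j))
  have hFb : ∀ z : Config (N + 1) (Fin 3) T3,
      |2 * ((n : ℝ)⁻¹ * ∑ j : Fin n, ∑ i, φ (Φ.flow ((((j : ℕ) : ℝ) + 1) * lag) z i).1 *
        g ((Real.sqrt θ)⁻¹ • ((Φ.flow ((((j : ℕ) : ℝ) + 1) * lag) z i).2 - u₀)))| ≤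
        2 * ((n : ℝ)⁻¹ * ∑ _j : Fin n, ∑ _i : Fin (N + 1), Cφ * Cg) := by
    intro z
    rw [abs_mul, abs_of_pos two_pos, abs_mul, abs_of_nonneg (inv_nonneg.2 n.cast_nonneg)]
    gcongr 2 * ((n : ℝ)⁻¹ * ?_)
    refine (Finset.abs_sum_le_sum_abs _ _).trans (Finset.sum_le_sum fun j _ => ?_)
    refine (Finset.abs_sum_le_sum_abs _ _).trans (Finset.sum_le_sum fun i _ => ?_)
    rw [abs_mul]
    exact mul_le_mul (hCφ _) (hCg _) (abs_nonneg _) hCφ0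
  subst hQ
  refine ⟨(tilted_klDiv_toReal_eq hFm hFb).1, (tilted_klDiv_toReal_eq hFm hFb).2.1,
    (tilted_klDiv_toReal_eq hFm hFb).2.2.1, fun B hB => ?_⟩
  refine lintegral_exp_le_of_tilted_budget hFm hFb (le_of_eq_of_le ?_ hB)
  congr 1
  exact (two_mul_integral_windowLaw_eq _ (fun i j z => (Φ.flow ((((j : ℕ) : ℝ) + 1) * lag) z i).1)
    (fun i j z => (Real.sqrt θ)⁻¹ • ((Φ.flow ((((j : ℕ) : ℝ) + 1) * lag) z i).2 - u₀)) hx hv hφ hg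
    hCφ hCg).symm

end Summit.AtomisticToContinuum.HydrodynamicLimit.Theorems.KineticEntropyCollisionBudget

end
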